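import Summits.BirchSwinnertonDyer.BirchSwinnertonDyer.Theorems.DerivedKatoValuationDoorStrictCapGivesSelmerCapOfDictionary
import Summits.BirchSwinnertonDyer.Rank1Residual.GaloisImage.KuriharaSelmerShaBookkeeping
import Literature.NumberTheory.EllipticCurves.Kato2004.IwasawaH1ReductionPkKernelProofs
import Literature.NumberTheory.EllipticCurves.Kato2004.H1TateModuleNoPTorsionProofs
import Literature.NumberTheory.EllipticCurves.Kato2004.IntegralH1SaturatedHullProofs
import Literature.NumberTheory.EllipticCurves.ZpCorankLowerBoundOfTorsionLevels
import Literature.NumberTheory.EllipticCurves.SelmerLevelToPrimary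
import Literature.NumberTheory.EllipticCurves.SelmerTorsionInclusion
import Literature.NumberTheory.EllipticCurves.KatoRankBoundSelmerProofs
import Literature.NumberTheory.EllipticCurves.NonEisensteinPrimeOfSurjective
import Mathlib.LinearAlgebra.FreeModule.PID
import Mathlib.LinearAlgebra.Dimension.Free
import HarnessLib

set_option linter.dupNamespace false
set_option autoImplicit false

/-!
# Stub `stub_rankIntegralH1LeSelmerCorankAtDoor` of line `birth` (r3) on the (β) crux
# `IntegralH1RankLeTwoOfAnalyticRankTwo` (stmt-BirchSwinnertonDyer-23752, route `DerivedKatoValuationDoor`) — PROVED: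
# at a door prime, under `ε_p = 1`, `rank_{ℤ_p} H¹(ℤ[1/p], T_pW) ≤ corank_{ℤ_p} Sel_{p^∞}(W/ℚ)`
# (the `≤` half of the compact-versus-discrete Selmer rank dictionary, INPUTS row G100b/G100c; seat
# `bsd-inputs-honda-p1` g14; `--supports 23752`)

The LEAD (dkd-p1 g3) reshaped the print stub `stub_lemme239` (= the named fact
`PerrinRiou1993.lemme239_rank_integralH1_eq_selmerCorank`) to the INEQUALITY at door primes on the INPUTS desk's
offer; this file proves it from the tree, with the bricks landed today:

* uniform Selmer multiplier `M` for ALL of `A = H¹(ℤ[1/p], T_pW)` (`exists_uniform_nsmul_reduceH1Pk_mem_selmerGroup_of_exists_log_ne_zero`,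
  from the `ε_p = 1` witness and the tree's Kurihara–Pollack line);
* the level maps `Sel^{(p^k)}(W/ℚ) → Sel_{p^∞}(W/ℚ)` (`WeierstrassCurve.torsionPowToPrimaryH1`, injective when `W(ℚ)[p] = 0`);
* `ker red_{p^k} = p^k · H¹(Γ_ℚ, T_pW)` (`Kato2004.exists_pow_smul_eq_of_reduceH1Pk_eq_zero`);
* `H¹(Γ_ℚ, T_pW)` is `ℤ_p`-torsion-free when `W(ℚ)[p] = 0` (`Kato2004.eq_zero_of_prime_pow_smul_eq_zero_of_torsionBy_eq_bot`);
  at a door prime `ρ̄_{W,p}` is onto, hence irreducible, hence `W(ℚ)[p] = 0` (`SelmerSha.torsionBy_point_eq_bot`);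
* the `p`-saturated hull `N ⊇ A` with `p^b N ⊆ A` (`Kato2004.exists_saturatedHull_integralH1`);
* the counting lemma `le_zpCorank_of_forall_exists_addSubgroup` (subgroups of `Sel_{p^∞}` of exponent `p^e` and order
  `≥ p^{e r}/C` for every `e` force `r ≤ corank`).

Argument.  `A` is finitely generated (`module_finite_integralH1_top`) and torsion-free, hence FREE of rank `r` over the
PID `ℤ_p`; fix a basis.  At level `e = k + 1` map `y ∈ A` to `Ψ_e(y) = ι_e(M • red_e y) ∈ Sel_{p^∞}(W/ℚ)`, a group
homomorphism killed by `p^e`.  If `Ψ_e(y) = 0` then `red_e(M y) = 0`, so `M y = p^e z`; writing `M = u p^a`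
(`PadicInt.unitCoeff`) and cancelling, `y = p^{e−a} w` with `w` in the hull `N`, whence `p^b y ∈ p^{e−a} A`: in
coordinates, `p^{e−a−b}` divides every coordinate of `y`.  So the `p^{(e−a−b) r}` classes `Ψ_e(∑ c_i b_i)`,
`0 ≤ c_i < p^{e−a−b}`, are pairwise distinct, and the counting lemma (with `C = p^{(a+b) r}`) gives
`r ≤ zpCorank (Sel_{p^∞}) = W.selmerCorank p`.  BSD is not proved by any of this; the crux S2 itself stays
open (it is `N1|door ∧ ε` modulo this theorem and the KP07 fact).

References: [PR93] = [cite: PerrinRiou1993AIF, Lemme 2.3.9 (p. 967) and §1.1–1.2]; [Kato04] = [cite: Kato2004Asterisque,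
§8.2, §13.8, §14.1 (pp. 234–235)]; [Gr99] = [cite: Greenberg1999LNM, §1 (pp. 54–57)]; [PR87] = [cite: PerrinRiou1987BSMF, §0].
-/

noncomputable section

open scoped Classical AddSubgroup

namespace Summit.BirchSwinnertonDyer.BirchSwinnertonDyer.Theorems.DerivedKatoValuationDoor

open Field
open Literature Literature.NumberTheory.GaloisRepresentations
open Literature.NumberTheory.EllipticCurves Literature.NumberTheory.EllipticCurves.Kato2004
open Literature.NumberTheory.EllipticCurves.Kato2004.EulerSystemValues
open WeierstrassCurve (geomPoints geomTorsion galH1Torsion galH1Primary selmerGroup selmerGroupPInfty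
  torsionPowToPrimaryH1 torsionH1OfDvd)

section Door

variable (W : WeierstrassCurve ℚ) [W.IsElliptic] (p : ℕ) [Fact p.Prime]

/-- At a door prime (`ρ̄_{W,p}` onto), `W(ℚ)[p] = 0`: onto ⇒ irreducible
(`hasIrreducibleModPGaloisRep_of_hasSurjectiveModNGaloisRep`) ⇒ no rational `p`-torsion
(`SelmerSha.torsionBy_point_eq_bot`). [cite: Mazur1977, Ch. III §5 (p. 157)] -/
theorem torsionBy_point_eq_bot_of_door (hsurj : W.HasSurjectiveModNGaloisRep p) :
    AddSubgroup.torsionBy W.toAffine.Point (p : ℤ) = ⊥ := by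
  haveI : NeZero (p : ℚ) := ⟨Nat.cast_ne_zero.mpr (Fact.out : p.Prime).ne_zero⟩
  have hirr := hasIrreducibleModPGaloisRep_of_hasSurjectiveModNGaloisRep W p hsurj
  have h := Summit.BirchSwinnertonDyer.Rank1Residual.GaloisImage.SelmerSha.torsionBy_point_eq_bot W p hirr 1
  simp only [pow_one] at h
  convert h using 2

/-- `H¹(Γ_ℚ, T_pW)` is a torsion-free `ℤ_p`-module when `W(ℚ)[p] = 0`: a non-zero `c ∈ ℤ_p` is `u p^a` with `u`
a unit (`PadicInt.unitCoeff_spec`), and `p^a • x = 0 ⇒ x = 0`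
(`Kato2004.eq_zero_of_prime_pow_smul_eq_zero_of_torsionBy_eq_bot`). [cite: Kato2004Asterisque, Thm. 12.4 (2) (p. 221)] -/
theorem smul_eq_zero_iff_of_torsionBy_eq_bot [ContinuousSMul ℤ_[p] (W.tateModule p)] (hK : AddSubgroup.torsionBy W.toAffine.Point (p : ℤ) = ⊥)
    (c : ℤ_[p]) (x : H1 (tateRep W p) ⊤) (h : c • x = 0) : c = 0 ∨ x = 0 := by
  by_cases hc : c = 0
  · exact Or.inl hc
  right
  have hspec := PadicInt.unitCoeff_spec hc
  have h' : ((p : ℤ_[p]) ^ c.valuation) • ((PadicInt.unitCoeff hc : ℤ_[p]) • x) = 0 := by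
    rw [smul_smul, mul_comm, ← hspec, h]
  have h'' := eq_zero_of_prime_pow_smul_eq_zero_of_torsionBy_eq_bot W p hK _ _ h'
  have : ((PadicInt.unitCoeff hc)⁻¹ : ℤ_[p]ˣ) • ((PadicInt.unitCoeff hc : ℤ_[p]) • x) = x := by
    rw [Units.smul_def, smul_smul, Units.inv_mul, one_smul]
  rw [← this, h'', smul_zero]

end Door

/-! ## The kernel of «multiply, reduce modulo `p^e`, push to `Sel_{p^∞}`» on `H¹(ℤ[1/p], T_pW)` -/

section Kernel

variable (W : WeierstrassCurve ℚ) [W.IsElliptic] (p : ℕ) [Fact p.Prime] [ContinuousSMul ℤ_[p] (W.tateModule p)]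

/-- Iterated saturation: if `p^n • z ∈ N` and `N` is closed under division by `p`, then `z ∈ N`. [folklore] -/
theorem mem_of_pow_smul_mem_of_saturated {N : Submodule ℤ_[p] (H1 (tateRep W p) ⊤)}
    (hsat : ∀ z : H1 (tateRep W p) ⊤, (p : ℤ_[p]) • z ∈ N → z ∈ N) (n : ℕ) :
    ∀ z : H1 (tateRep W p) ⊤, ((p : ℤ_[p]) ^ n) • z ∈ N → z ∈ N := by
  induction n with
  | zero => intro z hz; simpa using hz
  | succ n ih =>
    intro z hz
    apply hsat
    apply ih
    rwa [pow_succ, mul_smul] at hz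

/-- **Kernel analysis.**  Let `W(ℚ)[p] = 0`, let `N ⊇ A = H¹(ℤ[1/p], T_pW)` be `p`-saturated with `p^b N ⊆ A`, and let
`M ≠ 0`.  If `y ∈ A` has `red_{p^e}(M • y) = 0` and `e ≥ a := v_p(M)`, then `p^b • y ∈ p^{e−a} • A`: indeed
`M y = p^e z` (`exists_pow_smul_eq_of_reduceH1Pk_eq_zero`), `M = u p^a`, so `y = p^{e−a} (u⁻¹ z)` by torsion-freeness,
`u⁻¹ z ∈ N` by saturation, and `p^b u⁻¹ z ∈ A`. [cite: Kato2004Asterisque, §13.8 (p. 228) and §8.2 (pp. 180–181)] -/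
theorem exists_pow_smul_eq_of_reduceH1Pk_nsmul_eq_zero
    (hK : AddSubgroup.torsionBy W.toAffine.Point (p : ℤ) = ⊥)
    {N : Submodule ℤ_[p] (H1 (tateRep W p) ⊤)} (hAN : integralH1 (tateRep W p) p ⊤ ≤ N)
    (hsat : ∀ z : H1 (tateRep W p) ⊤, (p : ℤ_[p]) • z ∈ N → z ∈ N)
    {b : ℕ} (hb : ∀ z ∈ N, ((p : ℤ_[p]) ^ b) • z ∈ integralH1 (tateRep W p) p ⊤)
    {M : ℕ} (hM : M ≠ 0) {e : ℕ} (he : ((M : ℤ_[p])).valuation ≤ e)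
    {y : H1 (tateRep W p) ⊤} (hy : y ∈ integralH1 (tateRep W p) p ⊤)
    (hred : reduceH1Pk W p e ⊤ (M • y) = 0) :
    ∃ a' ∈ integralH1 (tateRep W p) p ⊤,
      ((p : ℤ_[p]) ^ b) • y = ((p : ℤ_[p]) ^ (e - (M : ℤ_[p]).valuation)) • a' := by
  have hM' : (M : ℤ_[p]) ≠ 0 := Nat.cast_ne_zero.mpr hM
  set a := (M : ℤ_[p]).valuation with ha
  set u := PadicInt.unitCoeff hM' with hu
  obtain ⟨z, hz⟩ := exists_pow_smul_eq_of_reduceH1Pk_eq_zero W p e ⊤ (M • y) hred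
  -- `M • y = u p^a • y = p^e • z`, so `u • y = p^{e-a} • z`
  have hMy : (M : ℤ_[p]) • y = ((p : ℤ_[p]) ^ e) • z := by rw [Nat.cast_smul_eq_nsmul]; exact hz.symm
  have hspec : (M : ℤ_[p]) = (u : ℤ_[p]) * (p : ℤ_[p]) ^ a := PadicInt.unitCoeff_spec hM'
  have hea : e = a + (e - a) := (Nat.add_sub_cancel' he).symm
  have hcancel : (u : ℤ_[p]) • y = ((p : ℤ_[p]) ^ (e - a)) • z := by
    apply eq_of_prime_pow_smul_eq_of_torsionBy_eq_bot W p hK a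
    rw [smul_smul, mul_comm, ← hspec, hMy, smul_smul, ← pow_add, ← hea]
  -- `w = u⁻¹ z`, `y = p^{e-a} w`, `w ∈ N`
  set w : H1 (tateRep W p) ⊤ := ((u⁻¹ : ℤ_[p]ˣ) : ℤ_[p]) • z with hw
  have hyw : y = ((p : ℤ_[p]) ^ (e - a)) • w := by
    have : y = ((u⁻¹ : ℤ_[p]ˣ) : ℤ_[p]) • ((u : ℤ_[p]) • y) := by
      rw [smul_smul, Units.inv_mul, one_smul]
    rw [this, hcancel, hw, smul_comm]
  have hwN : w ∈ N := by
    apply mem_of_pow_smul_mem_of_saturated W p hsat (e - a)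
    rw [← hyw]
    exact hAN hy
  refine ⟨((p : ℤ_[p]) ^ b) • w, hb w hwN, ?_⟩
  rw [hyw, smul_comm]

end Kernel

/-! ## The level map `Ψ_e : H¹(ℤ[1/p], T_pW) → Sel_{p^∞}(W/ℚ)` and the count -/

section Level

variable (W : WeierstrassCurve ℚ) [W.IsElliptic] (p : ℕ) [Fact p.Prime] [ContinuousSMul ℤ_[p] (W.tateModule p)]

/-- **The per-level subgroup.**  At a prime with `W(ℚ)[p] = 0`, given a uniform multiplier `M` putting
`M • red_{p^{k+1}} y` in `Sel^{(p^{k+1})}` for every `y ∈ A`, a `p`-saturated hull `N ⊇ A` with `p^b N ⊆ A`, and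
`a = v_p(M)`: there is a subgroup `H ≤ Sel_{p^∞}(W/ℚ)` killed by `p^{k+1}` with
`p^{(k+1)·r} ≤ p^{(a+b)·r} · #H`, `r = rank_{ℤ_p} A` (`A` is free over `ℤ_p`: finitely generated and torsion-free).
[cite: PerrinRiou1987BSMF, §0 (p. 401)] [cite: Greenberg1999LNM, §1–2 (pp. 54–63)] -/
theorem exists_addSubgroup_level (hK : AddSubgroup.torsionBy W.toAffine.Point (p : ℤ) = ⊥)
    {M : ℕ} (hM0 : M ≠ 0)
    (hM : ∀ y : H1 (tateRep W p) ⊤, y ∈ integralH1 (tateRep W p) p ⊤ → ∀ k : ℕ,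
      M • (ofTopSubgroup (W.torsionGaloisModule ((p : ℤ) ^ (k + 1))).toTopRep 1).hom
          (reduceH1Pk W p (k + 1) ⊤ y) ∈ selmerGroup W ((p : ℤ) ^ (k + 1)))
    {N : Submodule ℤ_[p] (H1 (tateRep W p) ⊤)} (hAN : integralH1 (tateRep W p) p ⊤ ≤ N)
    (hsat : ∀ z : H1 (tateRep W p) ⊤, (p : ℤ_[p]) • z ∈ N → z ∈ N)
    {b : ℕ} (hb : ∀ z ∈ N, ((p : ℤ_[p]) ^ b) • z ∈ integralH1 (tateRep W p) p ⊤) (k : ℕ) :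
    ∃ H : AddSubgroup ↥(selmerGroupPInfty W p), (∀ x ∈ H, p ^ (k + 1) • x = 0) ∧
      p ^ ((k + 1) * Module.finrank ℤ_[p] ↥(integralH1 (tateRep W p) p ⊤)) ≤
        p ^ (((M : ℤ_[p]).valuation + b) * Module.finrank ℤ_[p] ↥(integralH1 (tateRep W p) p ⊤)) *
          Nat.card H := by
  have hp : p.Prime := Fact.out
  set A := integralH1 (tateRep W p) p ⊤ with hA
  set e := k + 1 with he
  set a := (M : ℤ_[p]).valuation with ha
  set r := Module.finrank ℤ_[p] ↥A with hr
  -- `A` is finitely generated and torsion-free, hence free; fix a basis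
  haveI : Module.Finite ℤ_[p] ↥A := module_finite_integralH1_top W p
  haveI : Module.IsTorsionFree ℤ_[p] ↥A := Module.IsTorsionFree.of_smul_eq_zero fun c x hcx ↦ by
    rcases smul_eq_zero_iff_of_torsionBy_eq_bot W p hK c (x : H1 (tateRep W p) ⊤)
      (by rw [← Submodule.coe_smul, hcx, Submodule.coe_zero]) with h | h
    · exact Or.inl h
    · exact Or.inr (Subtype.ext h)
  let bas : Module.Basis (Fin r) ℤ_[p] ↥A := Module.finBasis ℤ_[p] ↥A
  -- the level map into `Sel_{p^∞}`: `Φ(y) = ι_e (M • red_e y)` (through the `(p:ℤ)^e ↪ ((p^e:ℕ):ℤ)` dialect map)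
  have hdvd : ((p : ℤ) ^ e) ∣ ((p ^ e : ℕ) : ℤ) :=
    Summit.BirchSwinnertonDyer.Rank1Residual.Additive.LocPKummer.intPow_dvd_natCast_pow' p e
  let cls : H1 (tateRep W p) ⊤ →+ galH1Torsion W ((p : ℤ) ^ e) :=
    ((nsmulAddMonoidHom M).comp
      (ofTopSubgroup (W.torsionGaloisModule ((p : ℤ) ^ e)).toTopRep 1).hom.toLinearMap.toAddMonoidHom).comp
      (reduceH1Pk W p e ⊤)
  have hcls : ∀ y : H1 (tateRep W p) ⊤, cls y =
      M • (ofTopSubgroup (W.torsionGaloisModule ((p : ℤ) ^ e)).toTopRep 1).hom (reduceH1Pk W p e ⊤ y) :=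
    fun _ ↦ rfl
  let Φ : H1 (tateRep W p) ⊤ →+ galH1Primary W p :=
    ((torsionPowToPrimaryH1 W p e).comp (torsionH1OfDvd W hdvd)).comp cls
  have hΦ : ∀ y : H1 (tateRep W p) ⊤, Φ y = torsionPowToPrimaryH1 W p e (torsionH1OfDvd W hdvd (cls y)) :=
    fun _ ↦ rfl
  have hΦsel : ∀ y : ↥A, Φ (y : H1 (tateRep W p) ⊤) ∈ selmerGroupPInfty W p := fun y ↦ by
    rw [hΦ]
    refine WeierstrassCurve.torsionPowToPrimaryH1_mem_selmerGroupPInfty W p e ?_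
    refine WeierstrassCurve.torsionH1OfDvd_mem_selmerGroup W _ ?_
    rw [hcls, he]
    exact hM y y.2 k
  let Ψ : ↥A →+ ↥(selmerGroupPInfty W p) :=
    (Φ.comp A.toAddSubgroup.subtype).codRestrict (selmerGroupPInfty W p) fun y ↦ hΦsel y
  have hΨ : ∀ y : ↥A, ((Ψ y : ↥(selmerGroupPInfty W p)) : galH1Primary W p) = Φ (y : H1 (tateRep W p) ⊤) :=
    fun _ ↦ rfl
  refine ⟨Ψ.range, ?_, ?_⟩
  · -- killed by `p^e`
    rintro x ⟨y, rfl⟩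
    apply Subtype.ext
    rw [AddSubgroupClass.coe_nsmul, hΨ, ZeroMemClass.coe_zero]
    rw [hΦ]
    exact WeierstrassCurve.pow_nsmul_torsionPowToPrimaryH1 W p e _
  · -- the count: `p^{(e-a-b) r}` distinct classes
    set m := e - (a + b) with hm
    -- kernel ⇒ `p^m` divides every coordinate
    have hker : ∀ y : ↥A, Ψ y = 0 → ∀ i, ((p : ℤ_[p]) ^ m) ∣ bas.repr y i := by
      intro y hy0 i
      by_cases hle : a + b ≤ e
      swap
      · have hm0 : m = 0 := by omega
        rw [hm0, pow_zero]; exact one_dvd _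
      have hΦ0 : Φ (y : H1 (tateRep W p) ⊤) = 0 := by
        rw [← hΨ, hy0, ZeroMemClass.coe_zero]
      -- `ι_e` and the dialect map are injective, `ofTop` is injective ⇒ `red_e (M y) = 0`
      have h1 : cls (y : H1 (tateRep W p) ⊤) = 0 := by
        have hι := WeierstrassCurve.torsionPowToPrimaryH1_injective_of_torsionBy_eq_bot W p e
          (by convert hK using 6)
        have h2 : torsionH1OfDvd W hdvd (cls y) = 0 := by
          apply hι
          rw [map_zero, ← hΦ]
          exact hΦ0
        -- the dialect map `E[(p:ℤ)^e] ↪ E[((p^e:ℕ):ℤ)]` (equal subgroups) is injective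
        have hinj := WeierstrassCurve.torsionH1OfDvd_injective W hdvd
          ⟨1, by rw [mul_one, Nat.cast_pow], by simp⟩
        apply hinj
        rw [map_zero]
        exact h2
      have hred : reduceH1Pk W p e ⊤ (M • (y : H1 (tateRep W p) ⊤)) = 0 := by
        rw [hcls, ← map_nsmul] at h1
        have := eq_zero_of_ofTopSubgroup_eq_zero _ _ h1
        rw [← map_nsmul] at this
        exact this
      obtain ⟨a', ha', hrel⟩ := exists_pow_smul_eq_of_reduceH1Pk_nsmul_eq_zero W p hK hAN hsat hb hM0
        (by omega) y.2 hred
      -- in coordinates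
      have hrelA : ((p : ℤ_[p]) ^ b) • y = ((p : ℤ_[p]) ^ (e - a)) • (⟨a', ha'⟩ : ↥A) :=
        Subtype.ext (by push_cast; exact hrel)
      have hcoord := congrArg (fun z : ↥A ↦ bas.repr z i) hrelA
      simp only [map_smul, Finsupp.smul_apply, smul_eq_mul] at hcoord
      have hsplit : e - a = b + m := by omega
      rw [hsplit, pow_add, mul_assoc] at hcoord
      have hpb : ((p : ℤ_[p]) ^ b) ≠ 0 := pow_ne_zero _ (Nat.cast_ne_zero.mpr hp.ne_zero)
      exact ⟨_, mul_left_cancel₀ hpb hcoord⟩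
    -- the injection `(Fin r → Fin (p^m)) → Ψ.range`
    haveI : Finite ↥Ψ.range := by
      haveI := WeierstrassCurve.finite_torsionBy_selmerGroupPInfty W (p := p)
      haveI := finite_torsionBy_pow (↥(selmerGroupPInfty W p)) p e
      refine Finite.of_injective (fun x : ↥Ψ.range ↦
        (⟨(x : ↥(selmerGroupPInfty W p)), AddSubgroup.torsionBy.nsmul_iff.mpr ?_⟩ :
          (↥(selmerGroupPInfty W p))[((p ^ e : ℕ) : ℤ)])) fun x y hxy ↦ ?_
      · obtain ⟨y, hy⟩ := x.2
        apply Subtype.ext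
        rw [AddSubgroupClass.coe_nsmul, ← hy, hΨ, ZeroMemClass.coe_zero, hΦ]
        exact WeierstrassCurve.pow_nsmul_torsionPowToPrimaryH1 W p e _
      · have h' := congrArg Subtype.val hxy
        exact Subtype.ext h'
    let vec : (Fin r → Fin (p ^ m)) → ↥A := fun c ↦ bas.equivFun.symm fun i ↦ ((c i : ℕ) : ℤ_[p])
    have hvec : ∀ c i, bas.repr (vec c) i = ((c i : ℕ) : ℤ_[p]) := fun c i ↦ by
      change bas.equivFun (bas.equivFun.symm _) i = _
      rw [LinearEquiv.apply_symm_apply]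
    let ι : (Fin r → Fin (p ^ m)) → ↥Ψ.range := fun c ↦ ⟨Ψ (vec c), ⟨vec c, rfl⟩⟩
    have hι : Function.Injective ι := by
      intro c c' hcc'
      have h0 : Ψ (vec c - vec c') = 0 := by
        rw [map_sub, sub_eq_zero]
        exact congrArg (fun z : ↥Ψ.range ↦ (z : ↥(selmerGroupPInfty W p))) hcc'
      funext i
      have hdvd := hker (vec c - vec c') h0 i
      rw [map_sub, Finsupp.sub_apply, hvec, hvec, ← Int.cast_natCast (c i : ℕ), ← Int.cast_natCast (c' i : ℕ),
        ← Int.cast_sub, PadicInt.pow_p_dvd_int_iff] at hdvd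
      have hlt : ((c i : ℕ) : ℤ) - ((c' i : ℕ) : ℤ) = 0 := by
        apply Int.eq_zero_of_abs_lt_dvd hdvd
        have h1 : ((c i : ℕ) : ℤ) < (p : ℤ) ^ m := by exact_mod_cast (c i).2
        have h2 : ((c' i : ℕ) : ℤ) < (p : ℤ) ^ m := by exact_mod_cast (c' i).2
        have h3 : (0 : ℤ) ≤ ((c i : ℕ) : ℤ) := by exact_mod_cast Nat.zero_le _
        have h4 : (0 : ℤ) ≤ ((c' i : ℕ) : ℤ) := by exact_mod_cast Nat.zero_le _
        rw [abs_sub_lt_iff]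
        constructor <;> omega
      exact Fin.ext (by exact_mod_cast sub_eq_zero.mp hlt)
    have hcard : p ^ (m * r) ≤ Nat.card ↥Ψ.range := by
      have := Nat.card_le_card_of_injective ι hι
      rwa [Nat.card_fun, Nat.card_eq_fintype_card, Fintype.card_fin, Nat.card_eq_fintype_card,
        Fintype.card_fin, ← pow_mul] at this
    -- assemble: `p^{e r} ≤ p^{(a+b) r} * p^{m r} ≤ p^{(a+b) r} * #range`
    calc p ^ (e * r) ≤ p ^ ((a + b) * r) * p ^ (m * r) := by
          rw [← pow_add, ← Nat.add_mul]
          exact Nat.pow_le_pow_right hp.pos (Nat.mul_le_mul_right r (by omega))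
      _ ≤ p ^ ((a + b) * r) * Nat.card ↥Ψ.range := Nat.mul_le_mul_left _ hcard

end Level

/-! ## The stub -/

/-- **Stub `stub_rankIntegralH1LeSelmerCorankAtDoor` (crux stmt-BirchSwinnertonDyer-23752, line `birth` r3) — the
registered signature VERBATIM, PROVED**: at a door prime (`5 ≤ p`, good ordinary, `ρ̄_{W,p}` onto) of a globally minimal
`W/ℚ`, if some integral class has a Kummer localisation of non-zero logarithm (`ε_p = 1`), then
`rank_{ℤ_p} H¹(ℤ[1/p], T_pW) ≤ corank_{ℤ_p} Sel_{p^∞}(W/ℚ)`.  Unconditional (tree theorems only; see the module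
docstring for the chain).  This is the `≤` half of the compact-versus-discrete Selmer rank dictionary
([PR93] Lemme 2.3.9 + §1.1–1.2, [Kato04] §14.1, [PR87] §0) at door primes; BSD is not proved by any of this.
[cite: PerrinRiou1993AIF, Lemme 2.3.9 (p. 967)] [cite: Kato2004Asterisque, §14.1 (pp. 234–235) and §13.8 (p. 228)]
[cite: PerrinRiou1987BSMF, §0 (p. 401)] -/
theorem stub_rankIntegralH1LeSelmerCorankAtDoor :
    ∀ (W : WeierstrassCurve ℚ) [W.IsElliptic] [W.IsGloballyMinimal] (p : ℕ) [Fact p.Prime]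
      [ContinuousSMul ℤ_[p] (W.tateModule p)],
      (5 ≤ p ∧ Literature.NumberTheory.EllipticCurves.IsOrdinaryAt W p ∧ W.HasSurjectiveModNGaloisRep p) →
      (∃ (x : H1 (tateRep W p) ⊤) (t : ℚ_[p]),
        x ∈ integralH1 (tateRep W p) p ⊤ ∧ t ≠ 0 ∧ HasLocPKummerLog W p x t) →
      Module.rank ℤ_[p] ↥(integralH1 (tateRep W p) p ⊤) ≤ (W.selmerCorank p : Cardinal) := by
  intro W _ _ p _ _ hdoor hε
  have hp : p.Prime := Fact.out
  have hK := torsionBy_point_eq_bot_of_door W p hdoor.2.2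
  -- uniform multiplier, saturated hull
  obtain ⟨M, hM0, hM⟩ := exists_uniform_nsmul_reduceH1Pk_mem_selmerGroup_of_exists_log_ne_zero W p hε
  obtain ⟨N, hAN, -, hsat, -, b, hb⟩ := exists_saturatedHull_integralH1 W p
  -- `Sel_{p^∞}` is `p`-primary with finite `p`-torsion
  have hprim : ∀ x : ↥(selmerGroupPInfty W p), ∃ n : ℕ, p ^ n • x = 0 := fun x ↦ by
    obtain ⟨n, hn⟩ := WeierstrassCurve.exists_pow_smul_galH1Primary_eq_zero W (x : galH1Primary W p)
    exact ⟨n, Subtype.ext (by rw [AddSubgroupClass.coe_nsmul, hn, ZeroMemClass.coe_zero])⟩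
  haveI := WeierstrassCurve.finite_torsionBy_selmerGroupPInfty W (p := p)
  haveI : Module.Finite ℤ_[p] ↥(integralH1 (tateRep W p) p ⊤) := module_finite_integralH1_top W p
  -- the counting lemma
  have hle : Module.finrank ℤ_[p] ↥(integralH1 (tateRep W p) p ⊤) ≤ zpCorank ↥(selmerGroupPInfty W p) p := by
    refine le_zpCorank_of_forall_exists_addSubgroup p hprim
      (C := p ^ (((M : ℤ_[p]).valuation + b) * Module.finrank ℤ_[p] ↥(integralH1 (tateRep W p) p ⊤)))
      fun e ↦ ?_
    cases e with
    | zero =>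
      refine ⟨⊥, fun x hx ↦ by rw [(AddSubgroup.mem_bot).mp hx, smul_zero], ?_⟩
      rw [zero_mul, pow_zero, AddSubgroup.card_bot, mul_one]
      exact Nat.one_le_pow _ _ hp.pos
    | succ k => exact exists_addSubgroup_level W p hK hM0 hM hAN hsat hb k
  have hsc : W.selmerCorank p = zpCorank ↥(selmerGroupPInfty W p) p := rfl
  rw [← Module.finrank_eq_rank, hsc]
  exact_mod_cast hle

end Summit.BirchSwinnertonDyer.BirchSwinnertonDyer.Theorems.DerivedKatoValuationDoor

end
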